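import Mathlib
import Literature.Analysis.FluidPDE.NSWave0
import HarnessLib

/-!
# NavierStokesRegularity — problem statement (D-0007: predetermined problem; this file is CREATED BY THE OPERATOR via docs/m5/create_problems.py, never proposed by agents)

Prop-valued definitions (main statement + variants), assembled by the M5 migration from:
* `harness21/H21/H21/Statements/NS/Wave0.lean` (1 defs)

Source: C. L. Fefferman, *Existence and smoothness of the Navier–Stokes equation*, Clay
Mathematics Institute Millennium Problem description (2000; printed 2006), statement (A) with
hypothesis (4) and conclusions (1), (2), (3), (6), (7). Glue predicates (`IsDivFree`,
`HasRapidSpatialDecay`, `IsSmoothOnHalfSpace`, `IsNavierStokesSolution`, `HasBoundedEnergy`) live in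
`Literature.Analysis.FluidPDE.NSWave0`.

## The four Clay statements and the BOARD RULE (D-0039 / D-0052, VARIANT R; operator revision 2026-08-25)

Fefferman's award condition is stated at the meta level [Clay problem description, p. 2, verbatim]: "A fundamental
problem in analysis is to decide whether such smooth, physically reasonable solutions exist for the Navier–Stokes
equations. To give reasonable leeway to solvers while retaining the heart of the problem, we ask for a proof of
one of the following four statements." The four statements, verbatim (p. 2; transcription audited by the refuter
cell `ns-clay`, REPORT.md §1, five independent passes, 2026-08-25):

* "(A) Existence and smoothness of Navier–Stokes solutions on ℝ³. Take ν > 0 and n = 3. Let u°(x) be any smooth,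
  divergence-free vector field satisfying (4). Take f(x,t) to be identically zero. Then there exist smooth
  functions p(x,t), uᵢ(x,t) on ℝ³ × [0,∞) that satisfy (1), (2), (3), (6), (7)."
  — TYPED HERE: `NavierStokesRegularity` := `Literature.NS.NavierStokesExistenceSmoothR3` (this file; the summit root).
* "(B) Existence and smoothness of Navier–Stokes solutions in ℝ³/ℤ³. Take ν > 0 and n = 3. Let u°(x) be any smooth,
  divergence-free vector field satisfying (8); we take f(x,t) to be identically zero. Then there exist smooth
  functions p(x,t), uᵢ(x,t) on ℝ³ × [0,∞) that satisfy (1), (2), (3), (10), (11)."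
  — TYPED as the conjecture leaf `Summit.NavierStokesRegularity.NavierStokesRegularity.NavierStokesExistenceSmoothPeriodic`
  (`Theorems/NavierStokesExistenceSmoothPeriodic.lean`; printed reading, (10) constrains `u` only).
* "(C) Breakdown of Navier–Stokes solutions on ℝ³. Take ν > 0 and n = 3. Then there exist a smooth, divergence-free
  vector field u°(x) on ℝ³ and a smooth f(x,t) on ℝ³ × [0,∞), satisfying (4), (5), for which there exist no
  solutions (p,u) of (1), (2), (3), (6), (7) on ℝ³ × [0,∞)."
  — TYPED as the conjecture leaf `Summit.NavierStokesRegularity.NavierStokesRegularity.NavierStokesBreakdownR3`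
  (`Theorems/NavierStokesBreakdownR3.lean`; the force `f` is smooth with the space-time decay (5)
  `|∂ₓ^α ∂ₜ^m f(x,t)| ≤ C_{αmK}(1+|x|+t)^{−K}` for all `α, m, K`).
* "(D) Breakdown of Navier–Stokes Solutions on ℝ³/ℤ³. Take ν > 0 and n = 3. Then there exist a smooth,
  divergence-free vector field u°(x) on ℝ³ and a smooth f(x,t) on ℝ³ × [0,∞), satisfying (8), (9), for which
  there exist no solutions (p,u) of (1), (2), (3), (10), (11) on ℝ³ × [0,∞)."
  — TYPED as the conjecture leaf `Summit.NavierStokesRegularity.NavierStokesRegularity.NavierStokesBreakdownPeriodic`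
  (`Theorems/NavierStokesBreakdownPeriodic.lean`; printed reading: force present with (8), (9); excluded solutions'
  `p` unconstrained) and, per the CMI offprint's ERRATA page ("The further condition p(x+eⱼ,t) = p(x,t) should be
  made explicit", read solution-side: excluded solutions have `u` AND `p` periodic), as the ERRATUM LEAF
  `Summit.NavierStokesRegularity.NavierStokesRegularity.NavierStokesBreakdownPeriodicPressurePeriodic`
  (`Theorems/NavierStokesBreakdownPeriodicPressurePeriodic.lean`, D-0052); printed-(D) implies errata-(D)
  (`Literature.Analysis.FluidPDE.NavierStokesBreakdownPeriodic.pressurePeriodic`).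

Conditions referenced (pp. 1–2, verbatim): (4) `|∂ₓ^α u°(x)| ≤ C_{αK}(1+|x|)^{−K}` on ℝⁿ, for any α and K;
(5) `|∂ₓ^α ∂ₜ^m f(x,t)| ≤ C_{αmK}(1+|x|+t)^{−K}` on ℝⁿ × [0,∞), for any α, m, K; (6) `p, u ∈ C∞(ℝⁿ × [0,∞))`;
(7) `∫_{ℝⁿ} |u(x,t)|² dx < C` for all t ≥ 0; (8) `u°(x+eⱼ) = u°(x), f(x+eⱼ,t) = f(x,t)` for 1 ≤ j ≤ n;
(9) `|∂ₓ^α ∂ₜ^m f(x,t)| ≤ C_{αmK}(1+|t|)^{−K}` on ℝ³ × [0,∞), for any α, m, K; (10) `u(x,t) = u(x+eⱼ,t)` on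
ℝ³ × [0,∞) for 1 ≤ j ≤ n; (11) `p, u ∈ C∞(ℝⁿ × [0,∞))`.

**BOARD RULE (D-0052).** The summit Prop `NavierStokesRegularity` below is, and stays, Clay (A) alone. The Millennium
problem — and this summit on the programme's board — is CLOSED by a kernel-checked (axioms ⊆ {propext,
Classical.choice, Quot.sound}) proof of ANY ONE of the four statements: `NavierStokesRegularity` itself (A); or
`NavierStokesExistenceSmoothPeriodic_holds` (B); or `NavierStokesBreakdownR3_holds` (C); or
`NavierStokesBreakdownPeriodic_holds` / `NavierStokesBreakdownPeriodicPressurePeriodic_holds` (D, printed / CMI-errata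
form). A proof of `¬ NavierStokesRegularity` closes it too: it yields (C) by the landed dichotomy
`Summit.NavierStokesRegularity.NavierStokesRegularity.Theorems.navierStokesRegularity_or_breakdownR3` ((A) ∨ (C),
from `navierStokesRegularity_of_not_breakdownR3`). Consequently the forced-breakdown targets (C)/(D) are
SUMMIT-BEARING. The literal disjunction (A) ∨ (B) ∨ (C) ∨ (D) is deliberately NOT the summit Prop: it is already a
theorem of the tree (one `Or`-weakening of (A) ∨ (C), by excluded middle plus the ν-scaling) and identifies no
clause, whereas the Clay text asks for a proof of one IDENTIFIED statement (cell ns-clay, REPORT.md §4; Tao,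
arXiv:1108.1165 §1: "a positive answer to either Conjecture 3 or 4, or a negative answer to Conjecture 5 or 6,
would qualify for the Clay Millennium Prize"). Nothing in the Lean declarations of this file changed under D-0052;
this section and the root docstring are the only revision.
-/

-- provenance: harness21/H21/H21/Statements/NS/Wave0.lean @ cb1f412 (interim HEAD d8f2665); M5 mechanical rewrite
open scoped ContDiff ENNReal
open Laplacian MeasureTheory

namespace Literature.NS

local notation "ℝ³" => EuclideanSpace ℝ (Fin 3)

noncomputable section

/-- **ns.S01** (Clay (A), existence and smoothness of Navier–Stokes solutions on `ℝ³`;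
Fefferman, Clay problem description (2000/2006), statement (A)).
Take `ν > 0` and `n = 3`. Let `u₀` be any smooth (`C^∞`), divergence-free vector field satisfying
the decay condition (4): `|∂ₓ^α u₀(x)| ≤ C_{αK} (1+|x|)^{-K}` for all `α, K`. Take `f ≡ 0`. Then
there exist smooth functions `p`, `u` on `ℝ³ × [0,∞)` (6) satisfying the Navier–Stokes system
(1), (2) for `t ≥ 0`, the initial condition (3), and bounded energy (7):
`∫_{ℝ³} |u(x,t)|² dx ≤ C` for all `t ≥ 0`. The viscosity is universally quantified ("take `ν > 0`";
all `ν > 0` are equivalent by the scaling `u ↦ a u(x, a t)`, `p ↦ a² p(x, a t)`, `a = ν'/ν`).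
Open. [folklore] [problem: ns] -/
def NavierStokesExistenceSmoothR3 : Prop :=
  ∀ ν : ℝ, 0 < ν → ∀ u₀ : ℝ³ → ℝ³, ContDiff ℝ ∞ u₀ → Literature.Analysis.FluidPDE.NSWave0.IsDivFree u₀ → Literature.Analysis.FluidPDE.HasRapidSpatialDecay u₀ →
    ∃ (u : ℝ → ℝ³ → ℝ³) (p : ℝ → ℝ³ → ℝ),
      Literature.Analysis.FluidPDE.IsSmoothOnHalfSpace u ∧ Literature.Analysis.FluidPDE.IsSmoothOnHalfSpace p ∧
        Literature.Analysis.FluidPDE.IsNavierStokesSolution ν 0 u₀ u p ∧ Literature.Analysis.FluidPDE.HasBoundedEnergy u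

end

end Literature.NS

/-- The `NavierStokesRegularity` problem statement (D-0010; canonical root-level name checked by the gate) := `Literature.NS.NavierStokesExistenceSmoothR3` = Clay (A). [problem: ns]
BOARD RULE (D-0039 / D-0052, Variant R): the Clay Millennium problem asks for "a proof of one of the following four
statements" (A), (B), (C), (D); this Prop is (A) and is unchanged. The summit CLOSES on a kernel-checked proof of
ANY ONE of the four: this Prop (A); `Summit.NavierStokesRegularity.NavierStokesRegularity.NavierStokesExistenceSmoothPeriodic`
(B); `Summit.NavierStokesRegularity.NavierStokesRegularity.NavierStokesBreakdownR3` (C);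
`Summit.NavierStokesRegularity.NavierStokesRegularity.NavierStokesBreakdownPeriodic` (D, printed) or its erratum leaf
`Summit.NavierStokesRegularity.NavierStokesRegularity.NavierStokesBreakdownPeriodicPressurePeriodic` (D, CMI-errata
reading) — each via its `_holds` theorem; `¬ NavierStokesRegularity` counts through (C)
(`navierStokesRegularity_or_breakdownR3`). The disjunction of the four is NOT the summit (it is a theorem by excluded
middle; see the module docstring). -/
def NavierStokesRegularity : Prop := Literature.NS.NavierStokesExistenceSmoothR3
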